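import Summits.ResolutionOfSingularities.ResolutionOfSingularities.Theorems.EquisingularLiftEquisingularLiftNatOrdTwoOneBlowupChart
import Literature.AlgebraicGeometry.Resolution.HypersurfaceTransformChart
import Literature.AlgebraicGeometry.Resolution.DerivativeIdealsLocalization
import Mathlib.Algebra.MvPolynomial.PDeriv
import HarnessLib

/-!
# [OURS · L1 W4.5(b)] L-ORD2, part 3: the POINTWISE CRITERION (a) on the chart — «simple root of the
# transversal quadratic form» (S1) and «a tangent vector field moves the equation» (S2) — crux
# `EquisingularLiftNat` (EL♮, stmt-ResolutionOfSingularities-20038), line `sections`,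
# research stub `stub_elnat_three` / T-ORD-type rungs (ordinary double curves)

NOT a statement of any manuscript. Part (a) of (R5) OPTION L-ORD2 of res-L1-w45b-plan-1's ORDERS
2026-08-27T05:49:16Z («CRITERION: `Bl_I(R/F)` regular over `z ∈ V(I)` unless some tangent direction
`λ` kills `q̄_z(λ)`, `q̄_z′(λ)`, `∇_Σ q_z(λ)` and `F̄₃,z(λ)` simultaneously»), in the form USED for
SPECIFIC (non-generic) hypersurfaces — the two sufficient clauses that certify the ordinary
singularities of T-ORD-type rungs (transversal `A₁` points: `q̄′_z(λ) ≠ 0`; pinch points: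
`∇_Σ q_z(λ) ≠ 0`). Parts 1–2 (`…OrdTwoOneBlowupChart`, `…OrdTwoOneBlowupGeneric`) settle the
GENERIC member by Bertini upstairs; this part needs no genericity and no base field.

**Setting.** Any commutative ring `A`; `x = (x₀, x₁)`, `I = (x₀, x₁)`, `{i, j} = {0, 1}`; the chart
`A[I/xᵢ]` (tree `blowupAlgebra`, `T = x_j/xᵢ = blowupAlgebra.frac x i j`); a presented member
`u = a x_j² + b x_j xᵢ + c xᵢ²` and its controlled transform `F′ = a T² + b T + c` (part 1:
`u = xᵢ² F′`; `(F′)` is the strict transform when `I` is a quasi-regular prime and `b ∉ I`).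

* `notMem_sq_maximalIdeal_of_derivation_apply_notMem` — a derivation `D` of `B` with `D f ∉ Q`
  certifies `f ∉ 𝔪_Q²` in `B_Q` (extend `D` to `B_Q`; `D(𝔪²) ⊆ 𝔪`);
  `isRegularLocalRing_localization_quotient_of_notMem_sq` — then `(B/(f))_𝔑 ≅ B_𝔐/(f)` is a regular
  local ring of dimension `dim B_𝔐 − 1` when `B_𝔐` is (Matsumura 14.2; localisation commutes with
  quotients, `BertiniAffine.locQuotEquiv`); `isRegularRing_quotient_span_singleton_of_forall_notMem_sq`
  — `B` regular and `f` of order one at every maximal `𝔐 ∋ f` ⇒ `B ⧸ (f)` is a regular ring;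
* `chartTransform_notMem_sq_of_pderiv_notMem` — **(S1)**, for ANY `A` and `x` quasi-regular: at a
  prime `𝔐 ∋ xᵢ` of the chart (a point of the exceptional divisor) with `2aT + b ∉ 𝔐`, `F′ ∉ 𝔪_𝔐²`
  (downstairs: `λ` a SIMPLE root of the transversal form `q̄_z`; characteristic `2`: `b̄(z) ≠ 0`).
  Proof: `∂/∂T` of the lift `aT² + bT + c ∈ A[T]` is a unit at `𝔐` and the relations of
  `A[T] ↠ A[I/xᵢ]` lie in `I·A[T] ⊆ (xᵢ)` (tree `notMem_sq_maximalIdeal_of_pderiv_notMem`, the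
  pattern of BGMW Lemma 3.6.4 (4), and Stacks 0BIQ via `blowupAlgebra.comap_eval_span_algebraMap_eq`);
  `algebraMap_mem_span_exceptional` — `I·A[I/xᵢ] ⊆ (xᵢ)`;
* `chartTransform_notMem_sq_of_derivation_notMem` — **(S2)**, for ANY `A`: a derivation `δ` of `A`
  with `δ(xᵢ) = 0`, `δ(I) ⊆ I` extends to `D` on `A[I/xᵢ]` (tree
  `exists_derivation_blowupAlgebra_of_apply_eq_zero`) with `D(F′) = δ(a)T² + δ(b)T + δ(c) +
  (2aT + b)·(δ(x_j)/xᵢ)`; where this does not vanish, `F′ ∉ 𝔪_𝔐²` (downstairs where (S1) fails: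
  `∇_Σ q_z(λ) ≠ 0`; e.g. the PINCH POINT `y² = x z²`, `δ = ∂/∂x`, `D(F′) = −1`);
* `isRegularRing_quotient_chartTransform_of_forall` — **(a) assembled**: `A` regular, `x`
  quasi-regular with `A/I` regular (so `A[I/xᵢ]` is regular, Liu 8.1.19 (a)); if every maximal
  `𝔐 ∋ F′` passes (S1) or (S2) (one `δ` fixed; `δ = 0` allowed), then `A[I/xᵢ] ⧸ (F′)` is a regular
  ring; `isRegularRing_blowupAlgebra_quotient_of_forall` — hence (for `I` prime, `b ∉ I`) the chart
  ring `(A/(u))[Ī/x̄ᵢ]` of `Bl_{V(I)} V(u)` is a regular ring.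

Not covered, and said so: the third clause `F̄₃,z(λ)` of the printed-style criterion (needed only
where (S1) and (S2) both fail), the necessity direction, and the points of the chart off the
exceptional divisor other than through (S2) (there `Bl` is an isomorphism onto `V(u) ∖ V(I)`).
References: [Matsumura1987] Thm. 14.2, 19.3; [Liu2002] Thm. 8.1.19 (a);
[BierstoneGrigorievMilmanWlodarczyk2011] Lemma 3.6.4 (4) (pattern of proof); [StacksProject] 0BIQ,
07Z3. [folklore]-level commutative algebra over the tree; axioms standard. AI-produced
formalisation, weaker than expert review.
-/

set_option linter.dupNamespace false -- mandated namespace `Summit.<Summit>.<Problem>` of this single-conjunct summit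

noncomputable section

open IsLocalRing MvPolynomial

universe u v

namespace Summit.ResolutionOfSingularities.ResolutionOfSingularities.Cruxes.EquisingularLiftNat.Sections

open Literature.AlgebraicGeometry.Resolution Literature.AlgebraicGeometry.Resolution.BertiniAffine

/-! ## Two bookkeeping lemmas over an abstract ring -/

/-- **A derivation certifies order one**: if `D f ∉ Q` for a derivation `D` of `B` and a prime
`Q`, then `f ∉ 𝔪_Q²` in `B_Q` (extend `D` to `B_Q`; derivations map `𝔪²` into `𝔪`). [folklore] -/
theorem notMem_sq_maximalIdeal_of_derivation_apply_notMem {R₀ : Type v} {B : Type u} [CommRing R₀]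
    [CommRing B] [Algebra R₀ B] (D : Derivation R₀ B B) (Q : Ideal B) [Q.IsPrime] {f : B}
    (hf : D f ∉ Q) :
    algebraMap B (Localization.AtPrime Q) f ∉ maximalIdeal (Localization.AtPrime Q) ^ 2 := by
  obtain ⟨D', hD'⟩ :=
    exists_derivation_extend_of_isLocalization R₀ (Localization.AtPrime Q) Q.primeCompl D
  intro hmem
  have h1 := Derivation.apply_mem_of_mem_pow_two D' _ hmem
  rw [hD', IsLocalization.AtPrime.to_map_mem_maximal_iff (Localization.AtPrime Q) Q] at h1
  exact hf h1

/-- **The local ring of a hypersurface at a point of order one is regular**: for `f ∈ B` and a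
prime `𝔑` of `B ⧸ (f)` whose contraction `𝔐` to `B` has `B_𝔐` regular and `f ∉ 𝔪_𝔐²`, the local
ring `(B/(f))_𝔑 ≅ B_𝔐/(f)` is a regular local ring of dimension `dim B_𝔐 - 1` (Matsumura 14.2;
localisation commutes with quotients). [cite: Matsumura1987, Thm. 14.2] -/
theorem isRegularLocalRing_localization_quotient_of_notMem_sq {B : Type u} [CommRing B] (f : B)
    (𝔑 : Ideal (B ⧸ Ideal.span {f})) [𝔑.IsPrime]
    [IsRegularLocalRing (Localization.AtPrime (𝔑.comap (Ideal.Quotient.mk (Ideal.span {f}))))]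
    (hf : algebraMap B (Localization.AtPrime (𝔑.comap (Ideal.Quotient.mk (Ideal.span {f})))) f ∉
      maximalIdeal (Localization.AtPrime (𝔑.comap (Ideal.Quotient.mk (Ideal.span {f})))) ^ 2) :
    IsRegularLocalRing (Localization.AtPrime 𝔑) ∧
      ringKrullDim (Localization.AtPrime 𝔑) + 1 =
        ringKrullDim (Localization.AtPrime (𝔑.comap (Ideal.Quotient.mk (Ideal.span {f})))) := by
  set 𝔐 := 𝔑.comap (Ideal.Quotient.mk (Ideal.span {f})) with h𝔐
  have hle : Ideal.span {f} ≤ 𝔐 := by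
    intro g hg
    rw [h𝔐, Ideal.mem_comap, Ideal.Quotient.eq_zero_iff_mem.mpr hg]
    exact 𝔑.zero_mem
  have hfm : algebraMap B (Localization.AtPrime 𝔐) f ∈ maximalIdeal (Localization.AtPrime 𝔐) := by
    rw [← Localization.AtPrime.map_eq_maximalIdeal]
    exact Ideal.mem_map_of_mem _ (hle (Ideal.mem_span_singleton_self f))
  obtain ⟨hreg, hdim⟩ := IsRegularLocalRing.quotient_span_singleton hfm hf
  have hmap : (Ideal.span {f}).map (algebraMap B (Localization.AtPrime 𝔐)) =
      Ideal.span {algebraMap B (Localization.AtPrime 𝔐) f} := by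
    rw [Ideal.map_span, Set.image_singleton]
  haveI : IsRegularLocalRing (Localization.AtPrime 𝔐 ⧸
      (Ideal.span {f}).map (algebraMap B (Localization.AtPrime 𝔐))) :=
    IsRegularLocalRing.of_ringEquiv (R := Localization.AtPrime 𝔐 ⧸
      Ideal.span {algebraMap B (Localization.AtPrime 𝔐) f}) (Ideal.quotEquivOfEq hmap.symm)
  have h𝔑eq : 𝔐.map (Ideal.Quotient.mk (Ideal.span {f})) = 𝔑 :=
    Ideal.map_comap_of_surjective _ Ideal.Quotient.mk_surjective 𝔑
  -- `(B/(f))_𝔑 ≅ B_𝔐/(f)`: both are the localisation of `B/(f)` at `𝔑 = 𝔐/(f)`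
  haveI := isPrime_map_mk (Ideal.span {f}) 𝔐 hle
  have hloc := isLocalization_atPrime_quotient (Ideal.span {f}) 𝔐 hle
  have hpc : (𝔐.map (Ideal.Quotient.mk (Ideal.span {f}))).primeCompl = 𝔑.primeCompl := by
    ext y
    rw [Ideal.mem_primeCompl_iff, Ideal.mem_primeCompl_iff, h𝔑eq]
  haveI : IsLocalization.AtPrime (Localization.AtPrime 𝔐 ⧸
      (Ideal.span {f}).map (algebraMap B (Localization.AtPrime 𝔐))) 𝔑 := by
    change IsLocalization 𝔑.primeCompl _
    rw [← hpc]
    exact hloc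
  let e' : (Localization.AtPrime 𝔐 ⧸ (Ideal.span {f}).map (algebraMap B (Localization.AtPrime 𝔐)))
      ≃ₐ[B ⧸ Ideal.span {f}] Localization.AtPrime 𝔑 :=
    IsLocalization.algEquiv 𝔑.primeCompl _ _
  refine ⟨IsRegularLocalRing.of_ringEquiv e'.toRingEquiv, ?_⟩
  rw [← ringKrullDim_eq_of_ringEquiv e'.toRingEquiv,
    ← ringKrullDim_eq_of_ringEquiv (Ideal.quotEquivOfEq hmap.symm)]
  exact hdim

/-- **A hypersurface of order one at each of its closed points in a regular ring is a regular
ring**: `B` regular, `f ∈ B` with `f ∉ 𝔪_𝔐²` in `B_𝔐` for every maximal `𝔐 ∋ f` ⇒ `B ⧸ (f)` is a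
regular ring (Matsumura 14.2 at each `𝔐`, then `isRegularRing_quotient_span_singleton_of_forall_isMaximal`).
[cite: Matsumura1987, Thm. 14.2, Thm. 19.3] -/
theorem isRegularRing_quotient_span_singleton_of_forall_notMem_sq {B : Type u} [CommRing B]
    [IsRegularRing B] (f : B)
    (h : ∀ (𝔐 : Ideal B) [𝔐.IsMaximal], f ∈ 𝔐 →
      algebraMap B (Localization.AtPrime 𝔐) f ∉ maximalIdeal (Localization.AtPrime 𝔐) ^ 2) :
    IsRegularRing (B ⧸ Ideal.span {f}) := by
  refine isRegularRing_quotient_span_singleton_of_forall_isMaximal f fun 𝔐 _ hf => ?_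
  have hfm : algebraMap B (Localization.AtPrime 𝔐) f ∈ maximalIdeal (Localization.AtPrime 𝔐) := by
    rw [← Localization.AtPrime.map_eq_maximalIdeal]
    exact Ideal.mem_map_of_mem _ hf
  exact (IsRegularLocalRing.quotient_span_singleton hfm (h 𝔐 hf)).1

/-! ## The chart `A[I/xᵢ]` and the controlled transform `F′ = a T² + b T + c`: two sufficient
criteria for ORDER ONE at a prime, and the regularity of the strict transform -/

section Chart

variable {A : Type u} [CommRing A] (x : Fin 2 → A) (i j : Fin 2)

/-- `I · A[I/xᵢ] ⊆ (xᵢ)`: the image of `w ∈ I` lies in the exceptional ideal. [cite: StacksProject, Tag 07Z3 (2)] -/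
theorem algebraMap_mem_span_exceptional {w : A} (hw : w ∈ Ideal.span (Set.range x)) :
    algebraMap A (blowupAlgebra (Ideal.span (Set.range x)) (x i)) w ∈
      Ideal.span {algebraMap A (blowupAlgebra (Ideal.span (Set.range x)) (x i)) (x i)} := by
  rw [← map_blowupAlgebra_eq_span (blowupAlgebra.mem_span_range x i)]
  exact Ideal.mem_map_of_mem _ hw

/-- **Criterion (S1) «simple root of the transversal quadratic form» — order one.** For ANY ring
`A`, `x = (x₀, x₁)` quasi-regular, `j ≠ i`: on the chart `A[I/xᵢ]` (`T = x_j/xᵢ`) the controlled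
transform `F′ = a T² + b T + c` of the presented member `a x_j² + b x_j xᵢ + c xᵢ²` is of ORDER
AT MOST ONE (`F′ ∉ 𝔪_𝔐²`) at every prime `𝔐` of the exceptional divisor (`xᵢ ∈ 𝔐`) at which the
`T`-derivative `2aT + b` does not vanish — downstairs reading at the point `(z, λ)` over `z ∈ Σ`:
`λ` is a SIMPLE root of the transversal quadratic form `q̄_z` (e.g. `z` a transversal-`A₁` point;
in characteristic `2`: `b̄(z) ≠ 0`). Proof: `∂/∂T` of the lift `aT² + bT + c ∈ A[T]` maps to a
unit at `𝔐` while the relations of `A[T] ↠ A[I/xᵢ]` lie in `I·A[T] ⊆ (xᵢ) ⊆ 𝔐` (tree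
`notMem_sq_maximalIdeal_of_pderiv_notMem`, the BGMW 3.6.4 (4) pattern).
[cite: BierstoneGrigorievMilmanWlodarczyk2011, Lemma 3.6.4 (4)] [cite: StacksProject, Tag 0BIQ]
[OURS · L1 W4.5b] helper L-ORD2 (a); NOT a statement of the manuscript. -/
theorem chartTransform_notMem_sq_of_pderiv_notMem (hji : j ≠ i) (hx : IsQuasiRegular x) (a b c : A)
    (𝔐 : Ideal (blowupAlgebra (Ideal.span (Set.range x)) (x i))) [𝔐.IsPrime]
    (hxi : algebraMap A (blowupAlgebra (Ideal.span (Set.range x)) (x i)) (x i) ∈ 𝔐)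
    (hd : 2 * algebraMap A (blowupAlgebra (Ideal.span (Set.range x)) (x i)) a *
        blowupAlgebra.frac x i j + algebraMap A _ b ∉ 𝔐) :
    algebraMap (blowupAlgebra (Ideal.span (Set.range x)) (x i)) (Localization.AtPrime 𝔐)
        (algebraMap A (blowupAlgebra (Ideal.span (Set.range x)) (x i)) a * blowupAlgebra.frac x i j ^ 2 +
          algebraMap A _ b * blowupAlgebra.frac x i j + algebraMap A _ c) ∉
      maximalIdeal (Localization.AtPrime 𝔐) ^ 2 := by
  classical
  -- the presentation `ψ : A[T] ↠ A[I/xᵢ]` and the lift `p` of `F′`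
  let ψ : MvPolynomial {l : Fin 2 // l ≠ i} A →+* blowupAlgebra (Ideal.span (Set.range x)) (x i) :=
    (blowupAlgebra.eval x i).toRingHom
  have hψ : Function.Surjective ψ := blowupAlgebra.eval_surjective x i
  let Xj : MvPolynomial {l : Fin 2 // l ≠ i} A := MvPolynomial.X ⟨j, hji⟩
  let p : MvPolynomial {l : Fin 2 // l ≠ i} A :=
    MvPolynomial.C a * Xj * Xj + MvPolynomial.C b * Xj + MvPolynomial.C c
  have hψX : ψ Xj = blowupAlgebra.frac x i j := blowupAlgebra.eval_X x i ⟨j, hji⟩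
  have hψC : ∀ r : A, ψ (MvPolynomial.C r) = algebraMap A _ r := fun r => blowupAlgebra.eval_C x i r
  have hψp : ψ p = algebraMap A (blowupAlgebra (Ideal.span (Set.range x)) (x i)) a *
        blowupAlgebra.frac x i j ^ 2 +
      algebraMap A _ b * blowupAlgebra.frac x i j + algebraMap A _ c := by
    simp only [p, map_add, map_mul, hψX, hψC]
    ring
  have hpd : MvPolynomial.pderiv ⟨j, hji⟩ p =
      MvPolynomial.C (2 : A) * MvPolynomial.C a * Xj + MvPolynomial.C b := by
    simp only [p, Xj, map_add, Derivation.leibniz, MvPolynomial.pderiv_C, MvPolynomial.pderiv_X_self,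
      smul_eq_mul, mul_one, mul_zero, add_zero, map_ofNat]
    ring
  have hψpd : ψ (MvPolynomial.pderiv ⟨j, hji⟩ p) =
      2 * algebraMap A (blowupAlgebra (Ideal.span (Set.range x)) (x i)) a * blowupAlgebra.frac x i j +
        algebraMap A _ b := by
    rw [hpd]
    simp only [map_add, map_mul, hψX, hψC, map_ofNat]
  have hKQ : ∀ w ∈ Ideal.span (Set.range x), ψ (MvPolynomial.C w) ∈ 𝔐 := by
    intro w hw
    rw [hψC]
    exact ((Ideal.span_singleton_le_iff_mem _).mpr hxi) (algebraMap_mem_span_exceptional x i hw)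
  have hp𝔐 : ψ (MvPolynomial.pderiv ⟨j, hji⟩ p) ∉ 𝔐 := by rw [hψpd]; exact hd
  -- the relations of `ψ` lie in `I·A[T]` (Stacks 0BIQ; the universe-`0` copy of this step is
  -- `…Theorems.ker_eval_le_map_C` of the WildQuotients NB1 file)
  have hker : RingHom.ker ψ ≤ Ideal.map MvPolynomial.C (Ideal.span (Set.range x)) := by
    intro q hq
    rw [← blowupAlgebra.comap_eval_span_algebraMap_eq x i hx, Ideal.mem_comap]
    rw [RingHom.mem_ker] at hq
    change ψ q ∈ _
    rw [hq]
    exact Ideal.zero_mem _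
  have hsq := notMem_sq_maximalIdeal_of_pderiv_notMem ψ hψ (Ideal.span (Set.range x))
    hker 𝔐 hKQ ⟨j, hji⟩ p hp𝔐
  rwa [hψp] at hsq

/-- **Criterion (S2) «a vector field of the ambient, tangent to the exceptional data, moves the
equation» — order one.** For ANY `A`, `x = (x₀, x₁)`, `I = (x₀, x₁)`, and a derivation `δ` of `A`
(over any base ring) with `δ(xᵢ) = 0` and `δ(I) ⊆ I` (e.g. `∂/∂x` along `Σ` on a coordinate chart),
let `D` be its extension to `A[I/xᵢ]` (`D(r) = δ(r)`, `D(x_j/xᵢ) = δ(x_j)/xᵢ`, tree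
`exists_derivation_blowupAlgebra_of_apply_eq_zero`). Then `D(F′) = δ(a) T² + δ(b) T + δ(c) +
(2aT + b)·(δ(x_j)/xᵢ)`, and `F′ = a T² + b T + c` is of order at most one (`F′ ∉ 𝔪_𝔐²`) at every
prime `𝔐` NOT containing this element — downstairs reading where (S1) fails: the derivative of
`q_z(λ)` ALONG `Σ` is non-zero, e.g. a PINCH POINT `y² = x z²` (`δ = ∂/∂x`, `D(F′) = −1`: order one
at EVERY prime of the chart). [folklore; a derivation maps `𝔪²` into `𝔪`] [OURS · L1 W4.5b] helper
L-ORD2 (a); NOT a statement of the manuscript. -/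
theorem chartTransform_notMem_sq_of_derivation_notMem {k₀ : Type v} [CommRing k₀] [Algebra k₀ A]
    (a b c : A) (δ : Derivation k₀ A A) (hδi : δ (x i) = 0)
    (hδI : ∀ w ∈ Ideal.span (Set.range x), δ w ∈ Ideal.span (Set.range x))
    (𝔐 : Ideal (blowupAlgebra (Ideal.span (Set.range x)) (x i))) [𝔐.IsPrime]
    (hD : algebraMap A (blowupAlgebra (Ideal.span (Set.range x)) (x i)) (δ a) *
            blowupAlgebra.frac x i j ^ 2 +
          algebraMap A _ (δ b) * blowupAlgebra.frac x i j + algebraMap A _ (δ c) +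
        (2 * algebraMap A _ a * blowupAlgebra.frac x i j + algebraMap A _ b) *
          blowupAlgebra.gen (Ideal.span (Set.range x)) (x i) (δ (x j))
            (hδI _ (blowupAlgebra.mem_span_range x j)) ∉ 𝔐) :
    algebraMap (blowupAlgebra (Ideal.span (Set.range x)) (x i)) (Localization.AtPrime 𝔐)
        (algebraMap A (blowupAlgebra (Ideal.span (Set.range x)) (x i)) a * blowupAlgebra.frac x i j ^ 2 +
          algebraMap A _ b * blowupAlgebra.frac x i j + algebraMap A _ c) ∉
      maximalIdeal (Localization.AtPrime 𝔐) ^ 2 := by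
  classical
  obtain ⟨D, hDr, hDgen⟩ := exists_derivation_blowupAlgebra_of_apply_eq_zero
    (I := Ideal.span (Set.range x)) (a := x i) k₀ δ hδi hδI
  have hDT : D (blowupAlgebra.frac x i j) = blowupAlgebra.gen (Ideal.span (Set.range x)) (x i)
      (δ (x j)) (hδI _ (blowupAlgebra.mem_span_range x j)) := hDgen (x j) _
  have hDF : D (algebraMap A (blowupAlgebra (Ideal.span (Set.range x)) (x i)) a *
        blowupAlgebra.frac x i j ^ 2 +
        algebraMap A _ b * blowupAlgebra.frac x i j + algebraMap A _ c) =
      algebraMap A (blowupAlgebra (Ideal.span (Set.range x)) (x i)) (δ a) *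
            blowupAlgebra.frac x i j ^ 2 +
          algebraMap A _ (δ b) * blowupAlgebra.frac x i j + algebraMap A _ (δ c) +
        (2 * algebraMap A _ a * blowupAlgebra.frac x i j + algebraMap A _ b) *
          blowupAlgebra.gen (Ideal.span (Set.range x)) (x i) (δ (x j))
            (hδI _ (blowupAlgebra.mem_span_range x j)) := by
    rw [map_add, map_add, Derivation.leibniz, Derivation.leibniz, Derivation.leibniz_pow, hDT, hDr,
      hDr, hDr]
    simp only [smul_eq_mul, nsmul_eq_mul, Nat.cast_ofNat]
    ring
  refine notMem_sq_maximalIdeal_of_derivation_apply_notMem D 𝔐 ?_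
  rw [hDF]
  exact hD

/-- **L-ORD2 (a): the strict transform is regular when (S1) or (S2) holds at each of its closed
points.** `A` regular, `x = (x₀, x₁)` quasi-regular with `A/I` regular (so the chart `A[I/xᵢ]`
is a regular ring, Liu 8.1.19 (a)), `j ≠ i`, `δ` a derivation of `A` with `δ(xᵢ) = 0`,
`δ(I) ⊆ I` (take `δ = 0` to use (S1) alone). If at every maximal ideal `𝔐 ∋ F′` of the chart
EITHER `xᵢ ∈ 𝔐` and `2aT + b ∉ 𝔐` (S1: simple root of the transversal form) OR `D(F′) ∉ 𝔐`
(S2), then the hypersurface ring `A[I/xᵢ] ⧸ (F′)` of the controlled (= strict, when `b ∉ I`,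
`ker_mapQuotient_eq_span_presented`) transform is a REGULAR RING. This is the downstairs check
«`Bl_Σ H` regular» for SPECIFIC (non-generic) hypersurfaces with an ordinary double curve:
transversal `A₁` points by (S1), pinch points by (S2). [cite: Matsumura1987, Thm. 14.2, Thm. 19.3]
[cite: Liu2002, Thm. 8.1.19 (a)] [OURS · L1 W4.5b] helper L-ORD2 (a) toward `stub_elnat_three` /
T-ORD-type rungs of crux `EquisingularLiftNat` (stmt-ResolutionOfSingularities-20038); NOT a
statement of the manuscript. -/
theorem isRegularRing_quotient_chartTransform_of_forall {k₀ : Type v} [CommRing k₀] [Algebra k₀ A]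
    [IsRegularRing A] (hji : j ≠ i) (hx : IsQuasiRegular x)
    [IsRegularRing (A ⧸ Ideal.span (Set.range x))] (a b c : A)
    (δ : Derivation k₀ A A) (hδi : δ (x i) = 0)
    (hδI : ∀ w ∈ Ideal.span (Set.range x), δ w ∈ Ideal.span (Set.range x))
    (htest : ∀ (𝔐 : Ideal (blowupAlgebra (Ideal.span (Set.range x)) (x i))) [𝔐.IsMaximal],
      algebraMap A (blowupAlgebra (Ideal.span (Set.range x)) (x i)) a * blowupAlgebra.frac x i j ^ 2 +
          algebraMap A _ b * blowupAlgebra.frac x i j + algebraMap A _ c ∈ 𝔐 →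
      (algebraMap A (blowupAlgebra (Ideal.span (Set.range x)) (x i)) (x i) ∈ 𝔐 ∧
        2 * algebraMap A (blowupAlgebra (Ideal.span (Set.range x)) (x i)) a *
          blowupAlgebra.frac x i j + algebraMap A _ b ∉ 𝔐) ∨
      algebraMap A (blowupAlgebra (Ideal.span (Set.range x)) (x i)) (δ a) *
            blowupAlgebra.frac x i j ^ 2 +
          algebraMap A _ (δ b) * blowupAlgebra.frac x i j + algebraMap A _ (δ c) +
        (2 * algebraMap A _ a * blowupAlgebra.frac x i j + algebraMap A _ b) *
          blowupAlgebra.gen (Ideal.span (Set.range x)) (x i) (δ (x j))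
            (hδI _ (blowupAlgebra.mem_span_range x j)) ∉ 𝔐) :
    IsRegularRing (blowupAlgebra (Ideal.span (Set.range x)) (x i) ⧸ Ideal.span
      {algebraMap A (blowupAlgebra (Ideal.span (Set.range x)) (x i)) a * blowupAlgebra.frac x i j ^ 2 +
        algebraMap A _ b * blowupAlgebra.frac x i j + algebraMap A _ c}) := by
  haveI : IsRegularRing (blowupAlgebra (Ideal.span (Set.range x)) (x i)) :=
    blowupAlgebra.isRegularRing x i hx
  refine isRegularRing_quotient_span_singleton_of_forall_notMem_sq _ fun 𝔐 _ hF => ?_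
  rcases htest 𝔐 hF with ⟨hxi, hd⟩ | hD
  · exact chartTransform_notMem_sq_of_pderiv_notMem x i j hji hx a b c 𝔐 hxi hd
  · exact chartTransform_notMem_sq_of_derivation_notMem x i j a b c δ hδi hδI 𝔐 hD

/-- **The same for the chart ring of the blow-up of the hypersurface.** Under the hypotheses of
`isRegularRing_quotient_chartTransform_of_forall` and with `I` prime and `b ∉ I` (so that `(F′)`
is the strict transform, `ker_mapQuotient_eq_span_presented`), the affine chart ring
`(A/(u))[Ī/x̄ᵢ]` of the blow-up of `V(u)`, `u = a x_j² + b x_j xᵢ + c xᵢ²`, along `V(I)` is a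
regular ring. [cite: Matsumura1987, Thm. 14.2, Thm. 19.3] [cite: Liu2002, Thm. 8.1.19 (a)]
[OURS · L1 W4.5b] helper L-ORD2 (a); NOT a statement of the manuscript. -/
theorem isRegularRing_blowupAlgebra_quotient_of_forall {k₀ : Type v} [CommRing k₀] [Algebra k₀ A]
    [IsRegularRing A] (hji : j ≠ i) (hx : IsQuasiRegular x) [(Ideal.span (Set.range x)).IsPrime]
    [IsRegularRing (A ⧸ Ideal.span (Set.range x))] (a b c u : A)
    (hu : u = a * x j ^ 2 + b * (x j * x i) + c * x i ^ 2) (hb : b ∉ Ideal.span (Set.range x))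
    (δ : Derivation k₀ A A) (hδi : δ (x i) = 0)
    (hδI : ∀ w ∈ Ideal.span (Set.range x), δ w ∈ Ideal.span (Set.range x))
    (htest : ∀ (𝔐 : Ideal (blowupAlgebra (Ideal.span (Set.range x)) (x i))) [𝔐.IsMaximal],
      algebraMap A (blowupAlgebra (Ideal.span (Set.range x)) (x i)) a * blowupAlgebra.frac x i j ^ 2 +
          algebraMap A _ b * blowupAlgebra.frac x i j + algebraMap A _ c ∈ 𝔐 →
      (algebraMap A (blowupAlgebra (Ideal.span (Set.range x)) (x i)) (x i) ∈ 𝔐 ∧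
        2 * algebraMap A (blowupAlgebra (Ideal.span (Set.range x)) (x i)) a *
          blowupAlgebra.frac x i j + algebraMap A _ b ∉ 𝔐) ∨
      algebraMap A (blowupAlgebra (Ideal.span (Set.range x)) (x i)) (δ a) *
            blowupAlgebra.frac x i j ^ 2 +
          algebraMap A _ (δ b) * blowupAlgebra.frac x i j + algebraMap A _ (δ c) +
        (2 * algebraMap A _ a * blowupAlgebra.frac x i j + algebraMap A _ b) *
          blowupAlgebra.gen (Ideal.span (Set.range x)) (x i) (δ (x j))
            (hδI _ (blowupAlgebra.mem_span_range x j)) ∉ 𝔐) :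
    IsRegularRing (blowupAlgebra ((Ideal.span (Set.range x)).map (Ideal.Quotient.mk (Ideal.span {u})))
      (Ideal.Quotient.mk (Ideal.span {u}) (x i))) := by
  have hker := ker_mapQuotient_eq_span_presented x i j hji hx a b c u hu hb
  haveI := isRegularRing_quotient_chartTransform_of_forall x i j hji hx a b c δ hδi hδI htest
  exact IsRegularRing.of_ringEquiv (R := blowupAlgebra (Ideal.span (Set.range x)) (x i) ⧸ Ideal.span
      {algebraMap A (blowupAlgebra (Ideal.span (Set.range x)) (x i)) a * blowupAlgebra.frac x i j ^ 2 +
        algebraMap A _ b * blowupAlgebra.frac x i j + algebraMap A _ c})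
    ((Ideal.quotEquivOfEq hker.symm).trans (RingHom.quotientKerEquivOfSurjective
      (blowupAlgebra.mapQuotient_surjective (Ideal.span (Set.range x)) (x i) (Ideal.span {u}))))

end Chart

end Summit.ResolutionOfSingularities.ResolutionOfSingularities.Cruxes.EquisingularLiftNat.Sections

end
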